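import Summits.FinalStateConjecture.FinalStateConjecture.Theorems.EIHFluxBalanceLLRadialCalculus
import Mathlib.Analysis.Calculus.LineDeriv.IntegrationByParts
import Mathlib.Analysis.Calculus.BumpFunction.Basic
import Mathlib.Analysis.Distribution.AEEqOfIntegralContDiff
import Mathlib.MeasureTheory.Integral.IntervalIntegral.FundThmCalculus
import Mathlib.Analysis.Calculus.ContDiff.Deriv
import Mathlib.Analysis.Calculus.ContDiff.WithLp

/-!
# Route EIHFluxBalance — `LLBalanceLaw` (iv): the flux of an antisymmetric divergence through a sphere vanishes

Helper file for the support item `stmt-FinalStateConjecture-10189`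
(`Summit.FinalStateConjecture.FinalStateConjecture.Theses.EIHFluxBalance.LLBalanceLaw`), clause (iv).
**Stokes on coordinate spheres without boundary calculus** (`setIntegral_sphere_antisymmDiv_eq_zero`):
if `A^{jl}` (`j, l = 1, 2, 3`) is `C¹` and antisymmetric on an open set `V ⊆ E3` containing the
sphere `{|y − ξ| = R}`, `R > 0`, then

  `∮_{|y−ξ|=R} Σ_{j,l} ((y − ξ)_j / R) ∂_l A^{jl}(y) dμHE[2](y) = 0`.

Proof (radial cutoff): for a test profile `g ∈ C_c^∞((R − δ', R + δ'))` with primitive `Φ`, the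
field `B^l = Σ_j P_j · A^{jl}`, `P_j = g(r)(y − ξ)_j/r = ∂_j Φ(|· − ξ|)`, is `C¹` and compactly
supported near the sphere, and `Σ_l ∂_l B^l = g(r) · G` with `G = Σ n_j ∂_l A^{jl}`
(`sum_fderiv_radialGrad_mul`: symmetric second derivatives against antisymmetric `A`); integrating by
parts on `E3` against a radial plateau (`integral_mul_fderiv_eq_neg_fderiv_mul_of_integrable`) gives
`∫ g(r) G = 0`; the shell formula (`llBalanceLaw_shell`) turns this into `∫ g(ρ) F(ρ) dρ = 0` for
`F(ρ) = ∮_{|y−ξ|=ρ} G`; so `F = 0` a.e. near `R` (`IsOpen.ae_eq_zero_of_integral_contDiff_smul_eq_zero`)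
and `F(R) = 0` by continuity (`continuousAt_setIntegral_sphere`). Landau–Lifshitz §96 use exactly
this vanishing ("the integral of `∂_m h^{ikm}` over a closed surface vanishes") between (96.10) and
(96.16).
-/

noncomputable section

open MeasureTheory MeasureTheory.Measure Set Function Filter Metric Module Real
open scoped Topology InnerProductSpace

namespace Summit.FinalStateConjecture.FinalStateConjecture.Theorems

namespace LLSphere

open Literature.Geometry.Lorentzian

/-! ### Integration by parts on `E3` against a plateau -/

/-- **`∫_{E3} ∂_v f = 0`** for `f` `C¹` on an open set `U` with topological support in `U` and
compact, granted a continuous plateau `ψ` with `tsupport ψ ⊆ U`, differentiable on `tsupport f`,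
and `ψ = 1`, `dψ = 0` on `tsupport f`: Mathlib's integration by parts
`∫ f ∂_v ψ = −∫ ∂_v f ψ` with `f ∂_v ψ ≡ 0` and `∂_v f · ψ ≡ ∂_v f`. [folklore] -/
theorem integral_fderiv_apply_eq_zero_of_plateau {f ψ : E3 → ℝ} {U : Set E3} (hU : IsOpen U)
    (hf : ContDiffOn ℝ 1 f U) (hfsupp : tsupport f ⊆ U) (hfc : HasCompactSupport f)
    (hψc : Continuous ψ) (hψsupp : tsupport ψ ⊆ U)
    (hψdiff : ∀ x ∈ tsupport f, DifferentiableAt ℝ ψ x)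
    (hψone : ∀ x ∈ tsupport f, fderiv ℝ ψ x = 0 ∧ ψ x = 1) (v : E3) :
    ∫ x, fderiv ℝ f x v = 0 := by
  have hfcont : Continuous f :=
    continuous_of_continuousOn_of_tsupport_subset hU hf.continuousOn hfsupp
  have hdf : Continuous fun x ↦ fderiv ℝ f x v :=
    continuous_of_continuousOn_of_tsupport_subset hU
      ((hf.continuousOn_fderiv_of_isOpen hU le_rfl).clm_apply continuousOn_const)
      ((tsupport_fderiv_apply_subset ℝ v).trans hfsupp)
  -- the two pointwise identities
  have hzero : (fun x ↦ f x * fderiv ℝ ψ x v) = fun _ ↦ 0 := by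
    funext x
    by_cases hx : x ∈ tsupport f
    · rw [(hψone x hx).1, zero_apply, mul_zero]
    · rw [image_eq_zero_of_notMem_tsupport hx, zero_mul]
  have hone : (fun x ↦ fderiv ℝ f x v * ψ x) = fun x ↦ fderiv ℝ f x v := by
    funext x
    by_cases hx : x ∈ tsupport f
    · rw [(hψone x hx).2, mul_one]
    · rw [fderiv_of_notMem_tsupport ℝ hx, zero_apply, zero_mul]
  have hibp := integral_mul_fderiv_eq_neg_fderiv_mul_of_integrable (μ := volume) (f := f)
    (g := ψ) (v := v) ?_ ?_ ?_ ?_ ?_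
  · rw [hzero, hone, integral_zero] at hibp
    linarith
  · rw [hone]
    exact hdf.integrable_of_hasCompactSupport (hfc.fderiv_apply (𝕜 := ℝ) v)
  · rw [hzero]
    exact integrable_zero _ _ _
  · exact (hfcont.mul hψc).integrable_of_hasCompactSupport hfc.mul_right
  · intro x hx
    exact (hf.differentiableOn one_ne_zero).differentiableAt (hU.mem_nhds (hψsupp hx))
  · exact hψdiff

/-! ### A radial plateau -/

/-- **A radial plateau**: for `0 < δ'` there is a continuous `ψ : E3 → ℝ` which is identically
`1` near every `x` with `R − δ' ≤ |x − ξ| ≤ R + δ'` (so differentiable there with vanishing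
derivative) and whose topological support lies in `{R − 3δ' ≤ |· − ξ| ≤ R + 3δ'}` (a
`ContDiffBump` in the radius). [folklore] -/
theorem exists_radial_plateau (ξ : E3) (R : ℝ) {δ' : ℝ} (hδ' : 0 < δ') :
    ∃ ψ : E3 → ℝ, Continuous ψ ∧
      (∀ x : E3, R - δ' ≤ dist x ξ ∧ dist x ξ ≤ R + δ' →
        DifferentiableAt ℝ ψ x ∧ fderiv ℝ ψ x = 0 ∧ ψ x = 1) ∧
      tsupport ψ ⊆ {x : E3 | R - 3 * δ' ≤ dist x ξ ∧ dist x ξ ≤ R + 3 * δ'} := by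
  let b : ContDiffBump (R : ℝ) := ⟨2 * δ', 3 * δ', by linarith, by linarith⟩
  have hd : Continuous fun x : E3 ↦ dist x ξ := continuous_id.dist continuous_const
  refine ⟨fun x ↦ b (dist x ξ), b.continuous.comp hd, ?_, ?_⟩
  · intro x hx
    have hx' : dist x ξ ∈ ball R b.rIn := by
      show dist x ξ ∈ ball R (2 * δ')
      rw [mem_ball, Real.dist_eq, abs_sub_lt_iff]
      constructor <;> linarith [hx.1, hx.2]
    have hev : (fun y : E3 ↦ b (dist y ξ)) =ᶠ[𝓝 x] fun _ ↦ (1 : ℝ) :=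
      (hd.continuousAt.eventually (b.eventuallyEq_one_of_mem_ball hx')).mono fun y hy ↦ by
        simpa using hy
    refine ⟨hev.differentiableAt_iff.mpr (differentiableAt_const _), ?_, hev.eq_of_nhds⟩
    rw [hev.fderiv_eq, fderiv_const_apply]
  · refine closure_minimal (fun y hy ↦ ?_) (isCompact_closedShell ξ R (3 * δ')).isClosed
    have hy' : dist y ξ ∈ support b := hy
    rw [b.support_eq, mem_ball, Real.dist_eq, abs_sub_lt_iff] at hy'
    have h3 : b.rOut = 3 * δ' := rfl
    rw [h3] at hy'
    exact ⟨by linarith [hy'.2], by linarith [hy'.1]⟩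

/-! ### The `E3` integral of `g(r) · Σ n_j ∂_l A^{jl}` vanishes -/

/-- **Core of the radial-cutoff argument.** `A^{jl}` `C¹` and antisymmetric on an open `V`
containing the closed shell `{R − 4δ' ≤ |y − ξ| ≤ R + 4δ'}` (`0 < 4δ' < R`), `g` smooth with
`tsupport g ⊆ (R − δ', R + δ')`: then `∫_{E3} (Σ_{j,l} ((y − ξ)_j/|y − ξ|) ∂_l A^{jl}) g(|y − ξ|) dy = 0`.
With `Φ' = g`, `W = Φ(|· − ξ|)`, `B^l = Σ_j ∂_j W · A^{jl}`: `Σ_l ∂_l B^l = g(r) Σ n_j ∂_l A^{jl}`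
(`sum_fderiv_radialGrad_mul`) and `∫ ∂_l B^l = 0` (`integral_fderiv_apply_eq_zero_of_plateau`).
[cite: LandauLifshitz1975, §96 (96.10)–(96.16)] -/
theorem integral_antisymmDiv_mul_radialTest_eq_zero {V : Set E3} (hV : IsOpen V) (ξ : E3)
    {R δ' : ℝ} (hδ' : 0 < δ') (h4 : 4 * δ' < R)
    (hshell : {y : E3 | R - 4 * δ' ≤ dist y ξ ∧ dist y ξ ≤ R + 4 * δ'} ⊆ V)
    {A : Fin 3 → Fin 3 → E3 → ℝ} (hA : ∀ j l, ContDiffOn ℝ 1 (A j l) V)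
    (hanti : ∀ j l y, A j l y = -A l j y) {g : ℝ → ℝ} (hg : ContDiff ℝ (⊤ : ℕ∞) g)
    (hgs : tsupport g ⊆ Ioo (R - δ') (R + δ')) :
    ∫ y, (∑ j : Fin 3, ∑ l : Fin 3, (y - ξ) j / dist y ξ *
      fderiv ℝ (A j l) y (EuclideanSpace.single l (1 : ℝ))) * g (dist y ξ) = 0 := by
  -- the open shell `S` on which everything is smooth
  set S : Set E3 := {y | R - 4 * δ' < dist y ξ ∧ dist y ξ < R + 4 * δ'} with hS_def
  have hd : Continuous fun x : E3 ↦ dist x ξ := continuous_id.dist continuous_const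
  have hSo : IsOpen S :=
    (isOpen_lt continuous_const hd).inter (isOpen_lt hd continuous_const)
  have hSV : S ⊆ V := fun y hy ↦ hshell ⟨hy.1.le, hy.2.le⟩
  have hSξ : ∀ y ∈ S, y ≠ ξ := by
    intro y hy h
    rw [h, mem_setOf_eq, dist_self] at hy
    linarith [hy.1]
  have hAd : ∀ j l, ∀ y ∈ S, DifferentiableAt ℝ (A j l) y := fun j l y hy ↦
    ((hA j l).differentiableOn one_ne_zero).differentiableAt (hV.mem_nhds (hSV hy))
  -- the primitive `Φ` of `g` and the radial potential `W`
  set Φ : ℝ → ℝ := fun ρ ↦ ∫ s in R..ρ, g s with hΦ_def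
  have hΦ' : ∀ ρ, HasDerivAt Φ (g ρ) ρ := fun ρ ↦
    (hg.continuous.integral_hasStrictDerivAt R ρ).hasDerivAt
  have hdΦ : deriv Φ = g := funext fun ρ ↦ (hΦ' ρ).deriv
  have hΦs : ContDiff ℝ (⊤ : ℕ∞) Φ :=
    contDiff_infty_iff_deriv.mpr ⟨fun ρ ↦ (hΦ' ρ).differentiableAt, by rwa [hdΦ]⟩
  set W : E3 → ℝ := fun y ↦ Φ (dist y ξ) with hW_def
  have hW2 : ∀ y : E3, y ≠ ξ → ContDiffAt ℝ 2 W y := fun y hy ↦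
    contDiffAt_infty.mp (contDiffAt_comp_dist hΦs hy) 2
  have hfdW : ∀ y : E3, y ≠ ξ → ∀ j : Fin 3,
      fderiv ℝ W y (EuclideanSpace.single j (1 : ℝ)) = g (dist y ξ) * (y - ξ) j / dist y ξ := by
    intro y hy j
    rw [fderiv_comp_dist_apply_single hy (hΦ' _).differentiableAt j, hdΦ]
  -- the vector field `B`
  set P : Fin 3 → E3 → ℝ := fun j y ↦ g (dist y ξ) * (y - ξ) j / dist y ξ with hP_def
  set B : Fin 3 → E3 → ℝ := fun l y ↦ ∑ j : Fin 3, P j y * A j l y with hB_def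
  -- supports
  have hK : ∀ y : E3, g (dist y ξ) ≠ 0 → R - δ' < dist y ξ ∧ dist y ξ < R + δ' :=
    fun y hy ↦ hgs (subset_tsupport _ hy)
  have hBsupp : ∀ l, support (B l) ⊆ {y : E3 | R - δ' ≤ dist y ξ ∧ dist y ξ ≤ R + δ'} := by
    intro l y hy
    have h0 : g (dist y ξ) ≠ 0 := by
      intro h0
      refine hy ?_
      simp only [hB_def, hP_def, h0, zero_mul, zero_div, Finset.sum_const_zero]
    exact ⟨(hK y h0).1.le, (hK y h0).2.le⟩
  have hBtsupp : ∀ l, tsupport (B l) ⊆ {y : E3 | R - δ' ≤ dist y ξ ∧ dist y ξ ≤ R + δ'} :=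
    fun l ↦ closure_minimal (hBsupp l) (isCompact_closedShell ξ R δ').isClosed
  have hBc : ∀ l, HasCompactSupport (B l) := fun l ↦
    HasCompactSupport.of_support_subset_isCompact (isCompact_closedShell ξ R δ') (hBsupp l)
  have hBS : ∀ l, tsupport (B l) ⊆ S := fun l y hy ↦
    ⟨by linarith [(hBtsupp l hy).1], by linarith [(hBtsupp l hy).2]⟩
  -- smoothness of `B` on `S`
  have hPd : ∀ j, ∀ y ∈ S, ContDiffAt ℝ 1 (P j) y := by
    intro j y hy
    have hyξ := hSξ y hy
    have h1 : ContDiffAt ℝ 1 (fun x : E3 ↦ g (dist x ξ)) y :=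
      contDiffAt_infty.mp (contDiffAt_comp_dist hg hyξ) 1
    have h2 : ContDiffAt ℝ 1 (fun x : E3 ↦ (x - ξ) j) y :=
      (contDiff_piLp_apply (𝕜 := ℝ) (p := 2) (i := j)).contDiffAt.comp y
        (contDiffAt_id.sub contDiffAt_const)
    have h3 : ContDiffAt ℝ 1 (fun x : E3 ↦ dist x ξ) y :=
      contDiffAt_comp_dist (Φ := id) contDiff_id hyξ
    exact (h1.mul h2).div h3 (dist_ne_zero.mpr hyξ)
  have hBd : ∀ l, ContDiffOn ℝ 1 (B l) S := fun l y hy ↦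
    (ContDiffAt.sum fun j _ ↦ (hPd j y hy).mul
      ((hA j l).contDiffAt (hV.mem_nhds (hSV hy)))).contDiffWithinAt
  -- plateau and integration by parts: `∫ ∂_l B^l = 0`
  obtain ⟨ψ, hψc, hψ1, hψs⟩ := exists_radial_plateau ξ R hδ'
  have hψS : tsupport ψ ⊆ S := fun y hy ↦
    ⟨by linarith [(hψs hy).1], by linarith [(hψs hy).2]⟩
  have hIBP : ∀ l, ∫ y, fderiv ℝ (B l) y (EuclideanSpace.single l (1 : ℝ)) = 0 := fun l ↦
    integral_fderiv_apply_eq_zero_of_plateau hSo (hBd l) (hBS l) (hBc l) hψc hψS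
      (fun y hy ↦ (hψ1 y (hBtsupp l hy)).1) (fun y hy ↦ (hψ1 y (hBtsupp l hy)).2)
      (EuclideanSpace.single l (1 : ℝ))
  -- the divergence identity, pointwise on all of `E3`
  have hdiv : ∀ y : E3, ∑ l : Fin 3, fderiv ℝ (B l) y (EuclideanSpace.single l (1 : ℝ)) =
      (∑ j : Fin 3, ∑ l : Fin 3, (y - ξ) j / dist y ξ *
        fderiv ℝ (A j l) y (EuclideanSpace.single l (1 : ℝ))) * g (dist y ξ) := by
    intro y
    by_cases hy : y ∈ S
    · have hyξ := hSξ y hy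
      -- near `y`, `B l` is `Σ_j ∂_j W · A^{jl}`
      have hloc : ∀ l, B l =ᶠ[𝓝 y]
          fun x ↦ ∑ j : Fin 3, fderiv ℝ W x (EuclideanSpace.single j (1 : ℝ)) * A j l x := by
        intro l
        filter_upwards [isOpen_ne.mem_nhds hyξ] with x hx
        simp only [hB_def, hP_def, hfdW x hx]
      have hsum : ∑ l : Fin 3, fderiv ℝ (B l) y (EuclideanSpace.single l (1 : ℝ)) =
          ∑ l : Fin 3, fderiv ℝ (fun x ↦ ∑ j : Fin 3,
            fderiv ℝ W x (EuclideanSpace.single j (1 : ℝ)) * A j l x) y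
              (EuclideanSpace.single l (1 : ℝ)) :=
        Finset.sum_congr rfl fun l _ ↦ by rw [(hloc l).fderiv_eq]
      rw [hsum, sum_fderiv_radialGrad_mul (hW2 y hyξ) (fun j l ↦ hAd j l y hy) hanti,
        Finset.sum_mul]
      refine Finset.sum_congr rfl fun j _ ↦ ?_
      rw [Finset.sum_mul]
      refine Finset.sum_congr rfl fun l _ ↦ ?_
      rw [hfdW y hyξ]
      ring
    · -- off `S` both sides vanish
      have hg0 : g (dist y ξ) = 0 := by
        by_contra h
        exact hy ⟨by linarith [(hK y h).1], by linarith [(hK y h).2]⟩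
      have hB0 : ∀ l, fderiv ℝ (B l) y = 0 := fun l ↦
        fderiv_of_notMem_tsupport ℝ fun h ↦ hy (hBS l h)
      simp only [hB0, zero_apply, Finset.sum_const_zero, hg0, mul_zero]
  -- integrate
  have hint : ∀ l, Integrable fun y ↦ fderiv ℝ (B l) y (EuclideanSpace.single l (1 : ℝ)) := by
    intro l
    refine Continuous.integrable_of_hasCompactSupport ?_ ((hBc l).fderiv_apply (𝕜 := ℝ) _)
    exact continuous_of_continuousOn_of_tsupport_subset hSo
      (((hBd l).continuousOn_fderiv_of_isOpen hSo le_rfl).clm_apply continuousOn_const)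
      ((tsupport_fderiv_apply_subset ℝ _).trans (hBS l))
  calc ∫ y, (∑ j : Fin 3, ∑ l : Fin 3, (y - ξ) j / dist y ξ *
          fderiv ℝ (A j l) y (EuclideanSpace.single l (1 : ℝ))) * g (dist y ξ)
      = ∫ y, ∑ l : Fin 3, fderiv ℝ (B l) y (EuclideanSpace.single l (1 : ℝ)) :=
        integral_congr_ae (Eventually.of_forall fun y ↦ (hdiv y).symm)
    _ = ∑ l : Fin 3, ∫ y, fderiv ℝ (B l) y (EuclideanSpace.single l (1 : ℝ)) :=
        integral_finsetSum _ fun l _ ↦ hint l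
    _ = 0 := Finset.sum_eq_zero fun l _ ↦ hIBP l

/-! ### The sphere flux vanishes -/

/-- **Flux of an antisymmetric divergence through a coordinate sphere vanishes.** For `A^{jl}`
`C¹` and antisymmetric on an open `V ⊇ {|y − ξ| = R}` (`R > 0`):
`∮_{|y−ξ|=R} Σ_{j,l} ((y − ξ)_j / R) ∂_l A^{jl} dμHE[2] = 0`. From
`integral_antisymmDiv_mul_radialTest_eq_zero` and the shell formula, `ρ ↦ ∮_{|y−ξ|=ρ} Σ n_j ∂_l A^{jl}`
integrates to zero against every test profile near `R`, so vanishes a.e. there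
(`IsOpen.ae_eq_zero_of_integral_contDiff_smul_eq_zero`), hence at `R` by continuity in the radius.
This is the "`∮ ∂_m h^{ikm} df_k = 0` over a closed surface" step of Landau–Lifshitz.
[cite: LandauLifshitz1975, §96 (96.16)] -/
theorem setIntegral_sphere_antisymmDiv_eq_zero {V : Set E3} (hV : IsOpen V) (ξ : E3) {R : ℝ}
    (hR : 0 < R) (hsub : sphere ξ R ⊆ V) {A : Fin 3 → Fin 3 → E3 → ℝ}
    (hA : ∀ j l, ContDiffOn ℝ 1 (A j l) V) (hanti : ∀ j l y, A j l y = -A l j y) :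
    ∫ y in sphere ξ R, (∑ j : Fin 3, ∑ l : Fin 3, (y - ξ) j / R *
      fderiv ℝ (A j l) y (EuclideanSpace.single l (1 : ℝ))) ∂(μHE[2] : Measure E3) = 0 := by
  obtain ⟨δ, hδ, hδR, hshell⟩ := exists_closedShell_subset hV hR hsub
  set δ' := δ / 4 with hδ'_def
  have hδ' : 0 < δ' := by positivity
  have h4 : 4 * δ' = δ := by rw [hδ'_def]; ring
  have hshell' : {y : E3 | R - 4 * δ' ≤ dist y ξ ∧ dist y ξ ≤ R + 4 * δ'} ⊆ V := by
    rw [h4]; exact hshell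
  have hd : Continuous fun x : E3 ↦ dist x ξ := continuous_id.dist continuous_const
  -- the integrand `G`, the open shell `S`, the sphere integrals `F`
  set G : E3 → ℝ := fun y ↦ ∑ j : Fin 3, ∑ l : Fin 3, (y - ξ) j / dist y ξ *
    fderiv ℝ (A j l) y (EuclideanSpace.single l (1 : ℝ)) with hG_def
  set S : Set E3 := {y | R - δ < dist y ξ ∧ dist y ξ < R + δ} with hS_def
  have hSo : IsOpen S :=
    (isOpen_lt continuous_const hd).inter (isOpen_lt hd continuous_const)
  have hSV : S ⊆ V := fun y hy ↦ hshell ⟨hy.1.le, hy.2.le⟩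
  have hSξ : ∀ y ∈ S, y ≠ ξ := by
    intro y hy h
    rw [h, hS_def, mem_setOf_eq, dist_self] at hy
    linarith [hy.1]
  have hGc : ContinuousOn G S := by
    refine continuousOn_finsetSum _ fun j _ ↦ continuousOn_finsetSum _ fun l _ ↦ ?_
    refine ContinuousOn.mul ?_
      ((((hA j l).continuousOn_fderiv_of_isOpen hV le_rfl).clm_apply continuousOn_const).mono hSV)
    exact (((contDiff_piLp_apply (𝕜 := ℝ) (n := 1) (p := 2) (i := j)).continuous.comp
      (continuous_id.sub continuous_const)).continuousOn).div₀ hd.continuousOn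
      fun y hy ↦ dist_ne_zero.mpr (hSξ y hy)
  set F : ℝ → ℝ := fun ρ ↦ ∫ y in sphere ξ ρ, G y ∂(μHE[2] : Measure E3) with hF_def
  have hI : ∀ ρ ∈ Ioo (R - δ') (R + δ'), 0 < ρ ∧ sphere ξ ρ ⊆ S := by
    intro ρ hρ
    refine ⟨by linarith [hρ.1], fun y hy ↦ ?_⟩
    rw [mem_sphere] at hy
    rw [hS_def, mem_setOf_eq, hy]
    exact ⟨by linarith [hρ.1], by linarith [hρ.2]⟩
  have hFc : ∀ ρ ∈ Ioo (R - δ') (R + δ'), ContinuousAt F ρ := fun ρ hρ ↦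
    continuousAt_setIntegral_sphere hSo hGc (hI ρ hρ).1 (hI ρ hρ).2
  -- Step 1: `∫ g • F = 0` for smooth profiles supported in `(R − δ', R + δ')`
  have hcore : ∀ g : ℝ → ℝ, ContDiff ℝ (⊤ : ℕ∞) g → HasCompactSupport g →
      tsupport g ⊆ Ioo (R - δ') (R + δ') → ∫ ρ, g ρ • F ρ = 0 := by
    intro g hg _ hgs
    have hK : ∀ ρ, g ρ ≠ 0 → R - δ' < ρ ∧ ρ < R + δ' := fun ρ h ↦ hgs (subset_tsupport _ h)
    have hE3 := integral_antisymmDiv_mul_radialTest_eq_zero hV ξ hδ' (by linarith) hshell' hA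
      hanti hg hgs
    -- continuity of `G · g(r)` on `E3`
    have hgr : Continuous fun y : E3 ↦ g (dist y ξ) := hg.continuous.comp hd
    have hgrS : tsupport (fun y : E3 ↦ g (dist y ξ)) ⊆ S := by
      refine (closure_minimal (fun y hy ↦ ?_) (isCompact_closedShell ξ R δ').isClosed).trans
        fun y hy ↦ ⟨by linarith [hy.1], by linarith [hy.2]⟩
      exact ⟨(hK _ hy).1.le, (hK _ hy).2.le⟩
    have hcont : Continuous fun y ↦ G y * g (dist y ξ) :=
      continuous_mul_of_continuousOn hSo hGc hgr hgrS
    -- the shell formula on radii `(R', 2R')`, `R' = (R + δ') / 2`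
    set R' : ℝ := (R + δ') / 2 with hR'_def
    have hR' : 0 < R' := by positivity
    have hIoo : ∀ ρ, R - δ' < ρ ∧ ρ < R + δ' → R' < ρ ∧ ρ < 2 * R' := fun ρ hρ ↦
      ⟨by linarith [hρ.1], by linarith [hρ.2]⟩
    have hsh := llBalanceLaw_shell (fun y ↦ G y * g (dist y ξ)) ξ R' hR' hcont
    calc ∫ ρ, g ρ • F ρ = ∫ ρ in Ioo R' (2 * R'), g ρ • F ρ := by
          refine (setIntegral_eq_integral_of_forall_compl_eq_zero fun ρ hρ ↦ ?_).symm
          have h0 : g ρ = 0 := by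
            by_contra h
            exact hρ (hIoo ρ (hK ρ h))
          rw [h0, zero_smul]
      _ = ∫ ρ in Ioo R' (2 * R'), ∫ y in sphere ξ ρ, G y * g (dist y ξ) ∂(μHE[2] : Measure E3) := by
          refine setIntegral_congr_fun measurableSet_Ioo fun ρ _ ↦ ?_
          simp only [hF_def, smul_eq_mul]
          rw [setIntegral_congr_fun isClosed_sphere.measurableSet
            (fun y (hy : y ∈ sphere ξ ρ) ↦ show G y * g (dist y ξ) = G y * g ρ by
              rw [mem_sphere.mp hy]), integral_mul_const, mul_comm]
      _ = ∫ y in {y : E3 | R' < dist y ξ ∧ dist y ξ < 2 * R'}, G y * g (dist y ξ) := hsh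
      _ = ∫ y, G y * g (dist y ξ) := by
          refine setIntegral_eq_integral_of_forall_compl_eq_zero fun y hy ↦ ?_
          have h0 : g (dist y ξ) = 0 := by
            by_contra h
            exact hy (hIoo _ (hK _ h))
          rw [h0, mul_zero]
      _ = 0 := hE3
  -- Step 2: `F = 0` a.e. near `R`
  have hFloc : LocallyIntegrableOn F (Ioo (R - δ') (R + δ')) :=
    ContinuousOn.locallyIntegrableOn (fun ρ hρ ↦ (hFc ρ hρ).continuousWithinAt)
      measurableSet_Ioo
  have hae := isOpen_Ioo.ae_eq_zero_of_integral_contDiff_smul_eq_zero hFloc hcore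
  -- Step 3: `F R = 0` by continuity
  have hRI : R ∈ Ioo (R - δ') (R + δ') := ⟨by linarith, by linarith⟩
  have hFR : F R = 0 := by
    by_contra hne
    have hev : ∀ᶠ ρ in 𝓝 R, F ρ ≠ 0 ∧ ρ ∈ Ioo (R - δ') (R + δ') :=
      ((hFc R hRI).eventually_ne hne).and (isOpen_Ioo.mem_nhds hRI)
    obtain ⟨ε, hε, hball⟩ := Metric.mem_nhds_iff.mp hev
    have hnull : volume (ball R ε) = 0 := by
      refine measure_mono_null hball ?_
      have hae' := hae
      rw [ae_iff] at hae'
      refine measure_mono_null (fun ρ hρ ↦ ?_) hae'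
      exact fun h ↦ hρ.1 (h hρ.2)
    exact (measure_ball_pos volume R hε).ne' hnull
  -- Step 4: on the sphere the integrand is `G`
  have hGR : ∫ y in sphere ξ R, (∑ j : Fin 3, ∑ l : Fin 3, (y - ξ) j / R *
      fderiv ℝ (A j l) y (EuclideanSpace.single l (1 : ℝ))) ∂(μHE[2] : Measure E3) = F R := by
    refine setIntegral_congr_fun isClosed_sphere.measurableSet fun y hy ↦ ?_
    rw [mem_sphere] at hy
    simp only [hG_def, hy]
  rw [hGR, hFR]

end LLSphere

end Summit.FinalStateConjecture.FinalStateConjecture.Theorems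

end
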